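import Mathlib
import Summits.ValiantsHypothesis.ValiantsHypothesis.Theses.ElementaryWordLength
import Literature.Computability.AlgebraicComplexity.StandardFamilies
import Literature.Computability.AlgebraicComplexity.PermanentIrreducible
import Summits.ValiantsHypothesis.ValiantsHypothesis.Theorems.ElementaryWordLengthWordLengthQPStubTransfer
import Summits.ValiantsHypothesis.ValiantsHypothesis.Theorems.ElementaryWordLengthWordLengthQPStubIndgLetters
import Summits.ValiantsHypothesis.ValiantsHypothesis.Theorems.ElementaryWordLengthWordLengthQPStubLetterMachine
import Summits.ValiantsHypothesis.ValiantsHypothesis.Theorems.ElementaryWordLengthWordLengthQPStubContinuantTop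
import Summits.ValiantsHypothesis.ValiantsHypothesis.Theorems.ElementaryWordLengthWordLengthQPStubPerTop
import Summits.ValiantsHypothesis.ValiantsHypothesis.Theorems.ElementaryWordLengthWordLengthQPStubPerPatternIrred
import Summits.ValiantsHypothesis.ValiantsHypothesis.Theorems.ElementaryWordLengthWordLengthQPStubMainAW
import Summits.ValiantsHypothesis.ValiantsHypothesis.Theorems.ElementaryWordLengthWordLengthQPLadderPosOfX

/-!
# Crux `WordLengthQP` (stmt-ValiantsHypothesis-6623), line `Sketch` (eps-order-ladder) —
rung `q = 0` of the ε-order ladder, UNCONDITIONALLY: Allender–Wang non-universality for the permanent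

Main results (all sorry-free; the six registered rung-0 stubs of skeleton v8 are imported):

* `rung0_lemmaB` (AW16 Cor. 37 / Remark 19, S-model, glued from `stub_indgLetters`,
  `stub_letterMachine`, `stub_continuantTop`): a product of S-affine width-2 matrices with unit
  determinants, between constant boundary matrices, computes a polynomial of degree `≤ 1` or one
  whose top homogeneous part is a product of two positive-degree polynomials;
* `rung0_perRobust` (from `stub_perTop`, `stub_perPatternIrred`): for `n ≥ 10` the permanent is
  8-robust (after any assignment of constants to `≤ 8` cells: degree `≥ 2`, top part not a
  product of two positive-degree polynomials);
* `rung0_nonuniversal` (Allender–Wang 2016 Thm 38-type, via `stub_mainAW`): for `n ≥ 10`, `per_n`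
  is not the `(0,0)` entry of ANY product of width-2 matrices over `ℂ[x̄]` with S-affine entries;
* `rung0_ladder_rung_zero`: hence the `q = 0` rung of the ε-order ladder holds for all `n ≥ 10`
  (discharging the hypothesis of the landed reduction `ladder_rung0_of_nonuniversal`, p111567);
* `rung0_ladder_of_ladder_pos`, `rung0_wordLengthQP_of_ladder_pos`: the full ladder, and the crux
  `WordLengthQP` BY NAME, follow from the rungs `q ≥ 1` alone (`stub_ladder_pos` of the
  skeleton, OPEN — the Extended Valiant Hypothesis above its settled exact rung);
* `rung0_ladderPos_iff_wordLengthQP`: with the landed converse `ladderPos_of_wordLengthQP`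
  (BIZ18 universality for `n ≤ 9`), the open stub is CERTIFIED crux-equivalent:
  `stub_ladder_pos ↔ WordLengthQP`.

Sources: E. Allender, F. Wang, *On the power of algebraic branching programs of width two*,
Comput. Complexity 25 (2016) 217–253 / ECCC TR11-083 (§3.1–3.3, §4.1); K. Bringmann,
C. Ikenmeyer, J. Zuiddam, *On algebraic branching programs of small width*, J. ACM 65 (2018) §5;
J. von zur Gathen, *Permanent and determinant*, Linear Algebra Appl. 96 (1987) Thm 3.4.
-/

-- `Summit.ValiantsHypothesis.ValiantsHypothesis.…` is the tree's mandated single-conjunct layout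
-- (Sub = Summit), so the duplicated namespace component is intended.
set_option linter.dupNamespace false

noncomputable section

open MvPolynomial

namespace Summit.ValiantsHypothesis.ValiantsHypothesis.Cruxes.WordLengthQP.EpsOrderLadder

open Literature.Computability.AlgebraicComplexity

/-! ### Glue (proved): the unit-determinant case `rung0_lemmaB` from the three letter stubs -/

/-- A polynomial whose top homogeneous part is a non-zero constant times a product of linear forms
has degree `≤ 1` or a top part that is a product of two positive-degree polynomials. [folklore] -/
theorem rung0_notRobust_of_topIsProd {σ : Type} (f : MvPolynomial σ ℂ) (κ : ℂ) (hκ : κ ≠ 0)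
    (lins : List (MvPolynomial σ ℂ)) (hlins : ∀ l ∈ lins, l.IsHomogeneous 1 ∧ l ≠ 0)
    (htop : MvPolynomial.homogeneousComponent f.totalDegree f = MvPolynomial.C κ * lins.prod) :
    f.totalDegree ≤ 1 ∨ ∃ g h : MvPolynomial σ ℂ, 0 < g.totalDegree ∧ 0 < h.totalDegree ∧
      MvPolynomial.homogeneousComponent f.totalDegree f = g * h := by
  -- a product of non-zero linear forms is non-zero and homogeneous of degree the number of factors
  have hprod : ∀ ls : List (MvPolynomial σ ℂ), (∀ l ∈ ls, l.IsHomogeneous 1 ∧ l ≠ 0) →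
      ls.prod.IsHomogeneous ls.length ∧ ls.prod ≠ 0 := by
    intro ls
    induction ls with
    | nil => intro _; exact ⟨by simpa using isHomogeneous_one σ ℂ, one_ne_zero⟩
    | cons l ls ih =>
      intro h
      have hl := h l (by simp)
      have ht := ih (fun l' hl' => h l' (by simp [hl']))
      refine ⟨?_, ?_⟩
      · simpa [List.prod_cons, List.length_cons, add_comm] using hl.1.mul ht.1
      · simpa [List.prod_cons] using mul_ne_zero hl.2 ht.2
  by_cases hf : f = 0
  · left; simp [hf]
  have htopne : MvPolynomial.homogeneousComponent f.totalDegree f ≠ 0 := by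
    -- a monomial of top degree exists by definition of `totalDegree`
    obtain ⟨e, he, hedeg⟩ := Finset.exists_mem_eq_sup f.support
      (Finset.nonempty_of_ne_empty (by rwa [Ne, support_eq_empty])) (fun s => s.sum fun _ n => n)
    intro h0
    have := congrArg (coeff e) h0
    rw [coeff_homogeneousComponent, coeff_zero, if_pos] at this
    · exact (mem_support_iff.1 he) this
    · rw [totalDegree, hedeg, Finsupp.degree_apply]
      rfl
  obtain ⟨hhom, hne⟩ := hprod lins hlins
  have hdeg : f.totalDegree = lins.length := by
    have h1 : (MvPolynomial.homogeneousComponent f.totalDegree f).IsHomogeneous f.totalDegree :=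
      homogeneousComponent_isHomogeneous _ _
    have h2 : (MvPolynomial.homogeneousComponent f.totalDegree f).IsHomogeneous lins.length := by
      rw [htop]
      simpa using (isHomogeneous_C σ κ).mul hhom
    exact h1.inj_right h2 htopne
  rcases lins with _ | ⟨l₁, _ | ⟨l₂, rest⟩⟩
  · left; simp [hdeg]
  · left; simp [hdeg]
  · right
    have h₁ := hlins l₁ (by simp)
    obtain ⟨hhom', hne'⟩ := hprod (l₂ :: rest) (fun l hl => hlins l (by simp_all))
    refine ⟨MvPolynomial.C κ * l₁, (l₂ :: rest).prod, ?_, ?_, ?_⟩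
    · have : (MvPolynomial.C κ * l₁).IsHomogeneous 1 := by
        simpa using (isHomogeneous_C σ κ).mul h₁.1
      rw [this.totalDegree (mul_ne_zero (by simpa using hκ) h₁.2)]
      exact one_pos
    · rw [hhom'.totalDegree hne']
      simp
    · rw [htop]
      simp [List.prod_cons, mul_assoc]

/-- The image of a constant matrix under an assignment-free ring map bookkeeping: the letters
`w^ε · diag(d₁, d₂)` form a constant matrix. [folklore] -/
theorem rung0_wPow_mul_diag_eq_map {σ : Type} (ε : ℕ) (d₁ d₂ : ℂ) :
    (!![0, 1; 1, 0] : Matrix (Fin 2) (Fin 2) (MvPolynomial σ ℂ)) ^ ε *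
        !![MvPolynomial.C d₁, 0; 0, MvPolynomial.C d₂] =
      (((!![0, 1; 1, 0] : Matrix (Fin 2) (Fin 2) ℂ) ^ ε * !![d₁, 0; 0, d₂]).map
        (MvPolynomial.C (σ := σ) (R := ℂ))) := by
  have h1 : ((!![0, 1; 1, 0] : Matrix (Fin 2) (Fin 2) ℂ).map (MvPolynomial.C (σ := σ) (R := ℂ)))
      = !![0, 1; 1, 0] := by
    ext i j; fin_cases i <;> fin_cases j <;> simp
  have h2 : ((!![d₁, 0; 0, d₂] : Matrix (Fin 2) (Fin 2) ℂ).map (MvPolynomial.C (σ := σ) (R := ℂ)))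
      = !![MvPolynomial.C d₁, 0; 0, MvPolynomial.C d₂] := by
    ext i j; fin_cases i <;> fin_cases j <;> simp
  rw [← (MvPolynomial.C (σ := σ) (R := ℂ)).mapMatrix_apply, map_mul, map_pow,
    RingHom.mapMatrix_apply, RingHom.mapMatrix_apply, h1, h2]

/-- **rung0_lemmaB** (AW16 Cor. 37 / Remark 19, S-model; glued from `stub_indgLetters`,
`stub_letterMachine`, `stub_continuantTop`): a product of S-affine width-2 matrices with unit
determinants, between constant boundary matrices, computes a polynomial of degree `≤ 1` or one
whose top homogeneous part is a product of two positive-degree polynomials. -/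
theorem rung0_lemmaB {σ : Type} [Fintype σ] [DecidableEq σ]
    (ms : List (Matrix (Fin 2) (Fin 2) (MvPolynomial σ ℂ))) (A B : Matrix (Fin 2) (Fin 2) ℂ)
    (hms : ∀ m ∈ ms, (∀ i j : Fin 2, (∃ b : ℂ, m i j = MvPolynomial.C b) ∨
        (∃ (a b : ℂ) (v : σ), m i j = MvPolynomial.C a * MvPolynomial.X v + MvPolynomial.C b)) ∧
      ∃ d : ℂ, d ≠ 0 ∧ m.det = MvPolynomial.C d)
    (f : MvPolynomial σ ℂ)
    (hf : f = ((A.map (MvPolynomial.C (σ := σ) (R := ℂ))) * ms.prod *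
      (B.map (MvPolynomial.C (σ := σ) (R := ℂ)))) 0 0) :
    f.totalDegree ≤ 1 ∨ ∃ g h : MvPolynomial σ ℂ, 0 < g.totalDegree ∧ 0 < h.totalDegree ∧
      MvPolynomial.homogeneousComponent f.totalDegree f = g * h := by
  classical
  -- (1) expand every matrix into letters
  have hws : ∃ ws : List (Matrix (Fin 2) (Fin 2) (MvPolynomial σ ℂ)),
      (∀ x ∈ ws, (∃ ℓ : MvPolynomial σ ℂ, ℓ.totalDegree ≤ 1 ∧ x = !![1, ℓ; 0, 1]) ∨
        x = !![0, 1; 1, 0] ∨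
        (∃ d₁ d₂ : ℂ, d₁ ≠ 0 ∧ d₂ ≠ 0 ∧
          x = !![MvPolynomial.C d₁, 0; 0, MvPolynomial.C d₂])) ∧
      ws.prod = ms.prod := by
    clear hf
    induction ms with
    | nil => exact ⟨[], by simp, by simp⟩
    | cons m ms ih =>
      obtain ⟨ws, hws, hprod⟩ := ih (fun m' hm' => hms m' (by simp [hm']))
      obtain ⟨ws₀, hws₀, hprod₀⟩ := stub_indgLetters m (hms m (by simp)).1 (hms m (by simp)).2
      refine ⟨ws₀ ++ ws, fun x hx => ?_, by simp [hprod, hprod₀]⟩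
      rcases List.mem_append.1 hx with h | h
      · exact hws₀ x h
      · exact hws x h
  obtain ⟨ws, hwsL, hwsprod⟩ := hws
  -- (2) the row vector `A 0` ; if it vanishes, `f = 0`
  by_cases hr : (fun k => A 0 k) = 0
  · left
    have hf0 : f = 0 := by
      rw [hf, Matrix.mul_apply]
      refine Finset.sum_eq_zero fun j _ => ?_
      rw [Matrix.mul_apply, Finset.sum_eq_zero, zero_mul]
      intro k _
      have : A 0 k = 0 := congrFun hr k
      simp [Matrix.map_apply, this]
    simp [hf0]
  -- (3) normal form of the row vector times the letter word
  obtain ⟨ls, ε, d₁, d₂, hd₁, hd₂, hdeg, hint, hvec⟩ :=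
    stub_letterMachine ws hwsL (fun k => A 0 k) hr
  -- the constant column produced by `w^ε · D · B`
  set W₀ : Matrix (Fin 2) (Fin 2) ℂ := (!![0, 1; 1, 0] : Matrix (Fin 2) (Fin 2) ℂ) ^ ε * !![d₁, 0; 0, d₂]
    with hW₀
  set c : Fin 2 → ℂ := fun k => ∑ j : Fin 2, W₀ k j * B j 0 with hc
  have hrow : ∀ j : Fin 2, ((A.map (MvPolynomial.C (σ := σ) (R := ℂ))) * ms.prod) 0 j =
      Matrix.vecMul (fun i => MvPolynomial.C (A 0 i)) ws.prod j := by
    intro j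
    rw [hwsprod]
    simp [Matrix.mul_apply, Matrix.vecMul, dotProduct, Matrix.map_apply]
  have hf' : f = ∑ k : Fin 2,
      (ls.map (fun L => (!![L, 1; 1, 0] : Matrix (Fin 2) (Fin 2) (MvPolynomial σ ℂ)))).prod 0 k *
        MvPolynomial.C (c k) := by
    rw [hf, Matrix.mul_apply]
    simp_rw [hrow, hvec]
    rw [Matrix.mul_assoc, rung0_wPow_mul_diag_eq_map, ← hW₀]
    simp only [Matrix.vecMul, dotProduct, Fin.sum_univ_two, Matrix.cons_val_zero,
      Matrix.cons_val_one, one_mul, zero_mul, add_zero,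
      Matrix.mul_apply, Matrix.map_apply, hc, map_add, map_mul]
    ring
  rcases stub_continuantTop ls hdeg hint c f hf' with h0 | ⟨κ, lins, hκ, hlins, htop⟩
  · left; simp [h0]
  · exact rung0_notRobust_of_topIsProd f κ hκ lins hlins htop

/-! ### Glue (proved): robustness of the permanent, rung 0, and the ladder -/

/-- **8-robustness of the permanent** (from `stub_perTop`, `stub_perPatternIrred`): for `n ≥ 10`,
after any assignment of constants to at most `8` cells, `per_n` has degree `≥ 2` and its top
homogeneous part is not a product of two positive-degree polynomials. -/
theorem rung0_perRobust (n : ℕ) (hn : 10 ≤ n) (Z : Finset (Fin n × Fin n)) (a : Fin n × Fin n → ℂ)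
    (hZ : Z.card ≤ 8) (f : MvPolynomial (Fin n × Fin n) ℂ)
    (hf : f = MvPolynomial.aeval
      (fun v : Fin n × Fin n => if v ∈ Z then MvPolynomial.C (a v) else MvPolynomial.X v)
      (Literature.Computability.AlgebraicComplexity.perPoly (Fin n) ℂ)) :
    2 ≤ f.totalDegree ∧ ¬ ∃ g h : MvPolynomial (Fin n × Fin n) ℂ,
      0 < g.totalDegree ∧ 0 < h.totalDegree ∧
      MvPolynomial.homogeneousComponent f.totalDegree f = g * h := by
  obtain ⟨hρ, hirr⟩ := stub_perPatternIrred n Z (by omega)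
  obtain ⟨hdeg, htop⟩ := stub_perTop n Z a hρ f hf
  refine ⟨by omega, ?_⟩
  rintro ⟨g, h, hg, hh, hgh⟩
  rw [hdeg, htop] at hgh
  rcases hirr g h hgh.symm with h0 | h0 <;> omega

/-- **Rung 0, unconditional** (Allender–Wang-type non-universality for the permanent, S-model):
for `n ≥ 10`, `per_n` is not the `(0,0)` entry of any product of width-2 matrices over `ℂ[x̄]`
with S-affine entries. -/
theorem rung0_nonuniversal (n : ℕ) (hn : 10 ≤ n)
    (ms : List (Matrix (Fin 2) (Fin 2) (MvPolynomial (Fin n × Fin n) ℂ)))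
    (hS : ∀ m ∈ ms, ∀ i j : Fin 2, (∃ b : ℂ, m i j = MvPolynomial.C b) ∨
      (∃ (a b : ℂ) (v : Fin n × Fin n),
        m i j = MvPolynomial.C a * MvPolynomial.X v + MvPolynomial.C b)) :
    ms.prod 0 0 ≠ Literature.Computability.AlgebraicComplexity.perPoly (Fin n) ℂ := by
  have h := stub_mainAW (σ := Fin n × Fin n)
    (Literature.Computability.AlgebraicComplexity.perPoly (Fin n) ℂ)
    (fun Z a hZ f hf => rung0_perRobust n hn Z a hZ f hf)
    (fun ms A B hms f hf => rung0_lemmaB ms A B hms f hf) ms hS 1 1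
  have h1 : ((1 : Matrix (Fin 2) (Fin 2) ℂ).map (MvPolynomial.C (σ := Fin n × Fin n) (R := ℂ))) = 1 :=
    Matrix.map_one _ (map_zero _) (map_one _)
  rwa [h1, one_mul, mul_one] at h

/-- **Rung 0 of the ladder, pointwise in `n`**: exact non-universality over `ℂ[x̄]` at `n` excludes
border width-2 S-affine programs of ε-order `0` (any length) at `n` — set `ε = 0`. [folklore] -/
theorem rung0_pointwise (n : ℕ)
    (h : ∀ ms : List (Matrix (Fin 2) (Fin 2) (MvPolynomial (Fin n × Fin n) ℂ)),
      (∀ m ∈ ms, ∀ i j : Fin 2, (∃ b : ℂ, m i j = MvPolynomial.C b) ∨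
        (∃ (a b : ℂ) (v : Fin n × Fin n),
          m i j = MvPolynomial.C a * MvPolynomial.X v + MvPolynomial.C b)) →
      ms.prod 0 0 ≠ Literature.Computability.AlgebraicComplexity.perPoly (Fin n) ℂ) :
    ¬ (∃ ms : List (Matrix (Fin 2) (Fin 2) (MvPolynomial (Fin n × Fin n) (Polynomial ℂ))),
        (∀ m ∈ ms, ∀ i j : Fin 2, (∃ b : Polynomial ℂ, m i j = MvPolynomial.C b) ∨
          (∃ (a b : Polynomial ℂ) (v : Fin n × Fin n),
            m i j = MvPolynomial.C a * MvPolynomial.X v + MvPolynomial.C b)) ∧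
        ∃ G : MvPolynomial (Fin n × Fin n) (Polynomial ℂ),
          ms.prod 0 0 = MvPolynomial.map Polynomial.C
              (Literature.Computability.AlgebraicComplexity.perPoly (Fin n) ℂ) +
            MvPolynomial.C Polynomial.X * G) := by
  rintro ⟨ms, hS, G, hG⟩
  set φ : MvPolynomial (Fin n × Fin n) (Polynomial ℂ) →+* MvPolynomial (Fin n × Fin n) ℂ :=
    MvPolynomial.map (Polynomial.evalRingHom 0) with hφ
  refine h (ms.map (fun m => φ.mapMatrix m)) ?_ ?_
  · intro m hm i j
    obtain ⟨m₀, hm₀, rfl⟩ := List.mem_map.1 hm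
    rcases hS m₀ hm₀ i j with ⟨b, hb⟩ | ⟨a, b, v, hab⟩
    · exact Or.inl ⟨b.eval 0, by simp [hφ, RingHom.mapMatrix_apply, hb, map_C]⟩
    · exact Or.inr ⟨a.eval 0, b.eval 0, v, by
        simp [hφ, RingHom.mapMatrix_apply, hab, map_C, map_X]⟩
  · have hprod : (ms.map (fun m => φ.mapMatrix m)).prod = φ.mapMatrix ms.prod :=
      (map_list_prod φ.mapMatrix ms).symm
    rw [hprod, RingHom.mapMatrix_apply, Matrix.map_apply, hG, map_add, map_mul,
      MvPolynomial.map_C, MvPolynomial.map_map]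
    have hcomp : (Polynomial.evalRingHom (0 : ℂ)).comp Polynomial.C = RingHom.id ℂ := by
      ext x
      simp
    rw [hcomp, MvPolynomial.map_id]
    simp

/-- **Rung `q = 0` of the ε-order ladder, unconditionally** (discharges the hypothesis of the
landed reduction `ladder_rung0_of_nonuniversal`): for all `n ≥ 10` no border width-2 S-affine
program over `ℂ[ε][x̄]` — of ANY length — has `(0,0)` entry `per_n + ε · G`. -/
theorem rung0_ladder_rung_zero :
    ∃ n₀ : ℕ, ∀ n ≥ n₀,
      ¬ (∃ ms : List (Matrix (Fin 2) (Fin 2) (MvPolynomial (Fin n × Fin n) (Polynomial ℂ))),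
          (∀ m ∈ ms, ∀ i j : Fin 2, (∃ b : Polynomial ℂ, m i j = MvPolynomial.C b) ∨
            (∃ (a b : Polynomial ℂ) (v : Fin n × Fin n),
              m i j = MvPolynomial.C a * MvPolynomial.X v + MvPolynomial.C b)) ∧
          ∃ G : MvPolynomial (Fin n × Fin n) (Polynomial ℂ),
            ms.prod 0 0 = MvPolynomial.map Polynomial.C
                (Literature.Computability.AlgebraicComplexity.perPoly (Fin n) ℂ) +
              MvPolynomial.C Polynomial.X * G) :=
  ⟨10, fun n hn => rung0_pointwise n (fun ms hS => rung0_nonuniversal n hn ms hS)⟩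

/-- **The full ε-order ladder from its rungs `q ≥ 1`.**  If for every `c` some `n ≥ 10` admits
no border width-2 S-affine program for `per_n` with `1 ≤ q ≤ 2^((log₂ n + c)^c)` and
`L ≤ 2^((log₂ n + c)^c)` (the open stub `stub_ladder_pos` of the skeleton), then the whole ladder
`EpsOrderLadder` holds — the rung `q = 0` being `rung0_nonuniversal`. -/
theorem rung0_ladder_of_ladder_pos
    (hpos : ∀ c : ℕ, ∃ n : ℕ, 10 ≤ n ∧ ∀ q L : ℕ, 1 ≤ q → q ≤ 2 ^ ((Nat.log 2 n + c) ^ c) →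
      L ≤ 2 ^ ((Nat.log 2 n + c) ^ c) →
      ¬ (∃ ms : List (Matrix (Fin 2) (Fin 2) (MvPolynomial (Fin n × Fin n) (Polynomial ℂ))),
          ms.length ≤ L ∧
          (∀ m ∈ ms, ∀ i j : Fin 2, (∃ b : Polynomial ℂ, m i j = MvPolynomial.C b) ∨
            (∃ (a b : Polynomial ℂ) (v : Fin n × Fin n),
              m i j = MvPolynomial.C a * MvPolynomial.X v + MvPolynomial.C b)) ∧
          ∃ G : MvPolynomial (Fin n × Fin n) (Polynomial ℂ),
            ms.prod 0 0 = MvPolynomial.C (Polynomial.X ^ q) *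
                MvPolynomial.map Polynomial.C
                  (Literature.Computability.AlgebraicComplexity.perPoly (Fin n) ℂ) +
              MvPolynomial.C (Polynomial.X ^ (q + 1)) * G)) :
    ∀ c : ℕ, ∃ n : ℕ, ∀ q L : ℕ, q ≤ 2 ^ ((Nat.log 2 n + c) ^ c) →
      L ≤ 2 ^ ((Nat.log 2 n + c) ^ c) →
      ¬ (∃ ms : List (Matrix (Fin 2) (Fin 2) (MvPolynomial (Fin n × Fin n) (Polynomial ℂ))),
          ms.length ≤ L ∧
          (∀ m ∈ ms, ∀ i j : Fin 2, (∃ b : Polynomial ℂ, m i j = MvPolynomial.C b) ∨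
            (∃ (a b : Polynomial ℂ) (v : Fin n × Fin n),
              m i j = MvPolynomial.C a * MvPolynomial.X v + MvPolynomial.C b)) ∧
          ∃ G : MvPolynomial (Fin n × Fin n) (Polynomial ℂ),
            ms.prod 0 0 = MvPolynomial.C (Polynomial.X ^ q) *
                MvPolynomial.map Polynomial.C
                  (Literature.Computability.AlgebraicComplexity.perPoly (Fin n) ℂ) +
              MvPolynomial.C (Polynomial.X ^ (q + 1)) * G) := by
  intro c
  obtain ⟨n, hn10, hposc⟩ := hpos c
  refine ⟨n, fun q L hq hL => ?_⟩
  rcases Nat.eq_zero_or_pos q with rfl | hq1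
  · rintro ⟨ms, -, hS, G, hG⟩
    refine rung0_pointwise n (fun ms' hS' => rung0_nonuniversal n hn10 ms' hS') ⟨ms, hS, G, ?_⟩
    simpa using hG
  · exact hposc q L hq1 hq hL

/-- **The crux from the rungs `q ≥ 1`.**  `WordLengthQP` (BY NAME) follows from the open part
`stub_ladder_pos` of the ladder alone: the landed transfer `stub_transfer` applied to
`rung0_ladder_of_ladder_pos`. -/
theorem rung0_wordLengthQP_of_ladder_pos
    (hpos : ∀ c : ℕ, ∃ n : ℕ, 10 ≤ n ∧ ∀ q L : ℕ, 1 ≤ q → q ≤ 2 ^ ((Nat.log 2 n + c) ^ c) →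
      L ≤ 2 ^ ((Nat.log 2 n + c) ^ c) →
      ¬ (∃ ms : List (Matrix (Fin 2) (Fin 2) (MvPolynomial (Fin n × Fin n) (Polynomial ℂ))),
          ms.length ≤ L ∧
          (∀ m ∈ ms, ∀ i j : Fin 2, (∃ b : Polynomial ℂ, m i j = MvPolynomial.C b) ∨
            (∃ (a b : Polynomial ℂ) (v : Fin n × Fin n),
              m i j = MvPolynomial.C a * MvPolynomial.X v + MvPolynomial.C b)) ∧
          ∃ G : MvPolynomial (Fin n × Fin n) (Polynomial ℂ),
            ms.prod 0 0 = MvPolynomial.C (Polynomial.X ^ q) *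
                MvPolynomial.map Polynomial.C
                  (Literature.Computability.AlgebraicComplexity.perPoly (Fin n) ℂ) +
              MvPolynomial.C (Polynomial.X ^ (q + 1)) * G)) :
    Summit.ValiantsHypothesis.ValiantsHypothesis.Theses.ElementaryWordLength.WordLengthQP := by
  unfold Summit.ValiantsHypothesis.ValiantsHypothesis.Theses.ElementaryWordLength.WordLengthQP
  exact stub_transfer (rung0_ladder_of_ladder_pos hpos)

/-- **The open stub is crux-equivalent** (certificate for the planners): the rungs `q ≥ 1` of the
ε-order ladder with witnesses `n ≥ 10` (`stub_ladder_pos` of the skeleton) hold if and only if the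
crux `WordLengthQP` does — `→` by `rung0_wordLengthQP_of_ladder_pos` (rung 0 is a theorem), `←` by
`ladderPos_of_wordLengthQP` (de-bordering + universality of border width 2 for `per_n`, `n ≤ 9`). -/
theorem rung0_ladderPos_iff_wordLengthQP :
    (∀ c : ℕ, ∃ n : ℕ, 10 ≤ n ∧ ∀ q L : ℕ, 1 ≤ q → q ≤ 2 ^ ((Nat.log 2 n + c) ^ c) →
      L ≤ 2 ^ ((Nat.log 2 n + c) ^ c) →
      ¬ (∃ ms : List (Matrix (Fin 2) (Fin 2) (MvPolynomial (Fin n × Fin n) (Polynomial ℂ))),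
          ms.length ≤ L ∧
          (∀ m ∈ ms, ∀ i j : Fin 2, (∃ b : Polynomial ℂ, m i j = MvPolynomial.C b) ∨
            (∃ (a b : Polynomial ℂ) (v : Fin n × Fin n),
              m i j = MvPolynomial.C a * MvPolynomial.X v + MvPolynomial.C b)) ∧
          ∃ G : MvPolynomial (Fin n × Fin n) (Polynomial ℂ),
            ms.prod 0 0 = MvPolynomial.C (Polynomial.X ^ q) *
                MvPolynomial.map Polynomial.C
                  (Literature.Computability.AlgebraicComplexity.perPoly (Fin n) ℂ) +
              MvPolynomial.C (Polynomial.X ^ (q + 1)) * G)) ↔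
    Summit.ValiantsHypothesis.ValiantsHypothesis.Theses.ElementaryWordLength.WordLengthQP :=
  ⟨rung0_wordLengthQP_of_ladder_pos, ladderPos_of_wordLengthQP⟩

end Summit.ValiantsHypothesis.ValiantsHypothesis.Cruxes.WordLengthQP.EpsOrderLadder
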